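import Mathlib.Analysis.SpecificLimits.Basic
import HarnessLib

/-!
# S2β · (SCT″-c)₁ — «ADMISSIBLE WEIGHTS»: the `(w, hw, W, hW)` binders of ✓p838904 `c1Budget_of_letters` ∕ ✓p840002 `c1Budget_of_bkg_letters` INHABITED, K-uniformly
# (`hW : ∀ n, Σ_{j ∈ Icc 1 n} (w j)⁻¹ ≤ W` quantifies ALL `n`, so the weight line `w j := L^{K−J−1−j}` — ℕ-subtraction, `= 1` for every `j ≥ K−J−1` — needs a summable TAIL):
# `w j := L^{N−1−j}` for `j ≤ N := K−J`, `2^j` beyond ⇒ `W := 6`; WEIGHT LINE v2 (`w 1 := 1`) ⇒ `W := 7`; both with the domination `w(i+1) ≤ L^{N−1−(i+1)}` of ✓p840002's `hwdom`.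

Cell `ym3-torus` (YM ladder rung R3 = continuum `SU(2)` Yang–Mills on the three-torus at fixed lattice data — a RUNG: NOT d = 4, NOT infinite volume, NOT a mass gap,
NOT Clay).  Width seat `ym-ust-20520-w4` (gen 29); crux `stmt-QuantumFields-20520`, LINE g18-1 S2β; piece (c) (offered 2026-09-01T02:09:20Z).
`--kind proof --supports stmt-QuantumFields-20520 --as helper`, count-neutral, DEFINITION-FREE (0 `def`, 0 `instance`, 0 `notation`, 0 `sorry`, default heartbeats).

WHAT IS PROVED (sorry-free; real arithmetic only).  ★`inv_pow_le_two_pow_div` (`(L^{N−1−j})⁻¹ ≤ 2^j ∕ 2^{N−1}`, `L ≥ 2`), ★`sum_head_le_four`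
(`Σ_{j ∈ Icc 1 n, j ≤ N} 2^j ∕ 2^{N−1} ≤ 4`, Mathlib `geom_sum_eq`), ★`sum_tail_le_two` (`Σ_{j ∈ Icc 1 n, N < j} (1∕2)^j ≤ 2`, Mathlib `sum_geometric_two_le`),
★★★`exists_admissible_weights (hL : 2 ≤ L) (N) : ∃ w, (∀ j, 0 < w j) ∧ (∀ n, Σ_{j ∈ Icc 1 n} (w j)⁻¹ ≤ 6) ∧ (∀ i < N, w (i+1) ≤ L^(N−1−(i+1))) ∧ (∀ j ≤ N, w j = L^(N−1−j))`
(the px10 weight line ✓p839746 up to the tower height), ★★★`exists_admissible_weights_v2 … : ∃ w, … ≤ 7 ∧ (domination) ∧ w 1 = 1 ∧ (∀ j, 2 ≤ j ≤ N → w j = L^(N−1−j))`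
(architect px17 g23 «WEIGHT LINE» v2, 2026-09-01T01:53:02Z).  USE: `obtain ⟨w, hw, hW, hwdom, hwline⟩ := exists_admissible_weights (by exact_mod_cast F.hL.2) (K − J)` then
`c1Budget_of_bkg_letters F hJK Cst hCst U₀ ζ w hw 6 hW … hwdom …`; `hwline` rewrites `E_R`∕`E_J` into the weight line's powers of `L` under `Finset.sum_congr`.

HONEST SCOPE.  Elementary real arithmetic; nothing of Bałaban's renormalisation-group analysis is asserted or proved ([Balaban1985Averaging] Prop. 4 (128)–(135) pp.37–38 is
where the weighted multi-level source sum lives); GAP♯∘ (`stub_uniformFibreGapOrbit`, registry 3732b7df UNTOUCHED, 0∕5), S2β, the five registered stubs, crux 20520, 19936,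
19200 and `YM3TorusSU2` are NOT proved; no registered stub is closed; rung R3 — NOT d = 4, NOT infinite volume, NOT a mass gap, NOT Clay; the Yang–Mills mass gap is NOT proved.
-/

set_option autoImplicit false

namespace Summit.QuantumFields.YangMills.Theorems.FluctuationComparisonRegPrIntLS2BetaAdmissibleWeights

open Finset

/-- ★ Head comparison: for `2 ≤ L` and `j ≤ N`, `(L^{N−1−j})⁻¹ ≤ 2^j ∕ 2^{N−1}` (ℕ-subtraction; at `j = N`, `N − 1` both sides saturate consistently). [folklore] -/
theorem inv_pow_le_two_pow_div {L : ℝ} (hL : 2 ≤ L) (N j : ℕ) :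
    (L ^ (N - 1 - j))⁻¹ ≤ (2 : ℝ) ^ j / 2 ^ (N - 1) := by
  have h2 : (0 : ℝ) < 2 := by norm_num
  have hA : ((2 : ℝ) ^ (N - 1 - j))⁻¹ ≤ (2 : ℝ) ^ j / 2 ^ (N - 1) := by
    rw [inv_le_iff_one_le_mul₀ (pow_pos h2 _), div_mul_eq_mul_div, one_le_div (pow_pos h2 _), ← pow_add]
    exact pow_le_pow_right₀ (by norm_num) (by omega)
  refine le_trans ?_ hA
  exact inv_anti₀ (pow_pos h2 _) (pow_le_pow_left₀ h2.le hL _)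

/-- ★ The head sum: `Σ_{j ∈ Icc 1 n, j ≤ N} 2^j ∕ 2^{N−1} ≤ 4`. [folklore] -/
theorem sum_head_le_four (N n : ℕ) :
    ∑ j ∈ Finset.Icc 1 n, (if j ≤ N then (2 : ℝ) ^ j / 2 ^ (N - 1) else 0) ≤ 4 := by
  have h2 : (0 : ℝ) < 2 := by norm_num
  rw [← Finset.sum_filter]
  have hsub : (Finset.Icc 1 n).filter (fun j => j ≤ N) ⊆ Finset.range (N + 1) := by
    intro j hj
    simp only [Finset.mem_filter, Finset.mem_Icc, Finset.mem_range] at hj ⊢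
    omega
  calc ∑ j ∈ (Finset.Icc 1 n).filter (fun j => j ≤ N), (2 : ℝ) ^ j / 2 ^ (N - 1)
      ≤ ∑ j ∈ Finset.range (N + 1), (2 : ℝ) ^ j / 2 ^ (N - 1) :=
        Finset.sum_le_sum_of_subset_of_nonneg hsub (fun j _ _ => by positivity)
    _ = (∑ j ∈ Finset.range (N + 1), (2 : ℝ) ^ j) / 2 ^ (N - 1) := by simp_rw [div_eq_mul_inv]; rw [Finset.sum_mul]
    _ = ((2 : ℝ) ^ (N + 1) - 1) / 2 ^ (N - 1) := by
        rw [geom_sum_eq (by norm_num : (2 : ℝ) ≠ 1) (N + 1)]; norm_num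
    _ ≤ (2 : ℝ) ^ (N + 1) / 2 ^ (N - 1) := by
        gcongr; linarith
    _ ≤ 4 := by
        rw [div_le_iff₀ (pow_pos h2 _)]
        rcases Nat.eq_zero_or_pos N with rfl | hN
        · norm_num
        · rw [show N + 1 = (N - 1) + 2 by omega, pow_add]; norm_num; exact le_of_eq (by ring)

/-- ★ The tail sum: `Σ_{j ∈ Icc 1 n, N < j} (1∕2)^j ≤ 2`. [folklore] -/
theorem sum_tail_le_two (N n : ℕ) :
    ∑ j ∈ Finset.Icc 1 n, (if N < j then (1 / 2 : ℝ) ^ j else 0) ≤ 2 := by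
  calc ∑ j ∈ Finset.Icc 1 n, (if N < j then (1 / 2 : ℝ) ^ j else 0)
      ≤ ∑ j ∈ Finset.Icc 1 n, (1 / 2 : ℝ) ^ j :=
        Finset.sum_le_sum fun j _ => by split_ifs; exacts [le_rfl, by positivity]
    _ ≤ ∑ j ∈ Finset.range (n + 1), (1 / 2 : ℝ) ^ j :=
        Finset.sum_le_sum_of_subset_of_nonneg (fun j hj => by
          simp only [Finset.mem_Icc, Finset.mem_range] at hj ⊢; omega) (fun j _ _ => by positivity)
    _ ≤ 2 := sum_geometric_two_le _

/-- ★★★ **ADMISSIBLE WEIGHTS** for ✓`c1Budget_of_letters`' `(w, hw, W, hW)` binders (`hW` quantifies ALL `n`, so the tail beyond the tower height must grow) with the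
weight-line domination `w(i+1) ≤ L^{N−1−(i+1)}` of ✓`c1Budget_of_bkg_letters` (`N := K − J`): `w j := L^{N−1−j}` for `j ≤ N` (px10's∕the architect's weight line
up to the envelope), `w j := 2^j` beyond; `W := 6` works for every `L ≥ 2`, uniformly in `N`. [cite: Balaban1985Averaging, Prop. 4 (128)-(135) pp.37-38] -/
theorem exists_admissible_weights {L : ℝ} (hL : 2 ≤ L) (N : ℕ) :
    ∃ w : ℕ → ℝ, (∀ j, 0 < w j) ∧ (∀ n, ∑ j ∈ Finset.Icc 1 n, (w j)⁻¹ ≤ 6) ∧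
      (∀ i, i < N → w (i + 1) ≤ L ^ (N - 1 - (i + 1))) ∧ (∀ j, j ≤ N → w j = L ^ (N - 1 - j)) := by
  have hL0 : 0 < L := by linarith
  refine ⟨fun j => if j ≤ N then L ^ (N - 1 - j) else (2 : ℝ) ^ j, ?_, ?_, ?_, ?_⟩
  · intro j; dsimp only; split_ifs <;> positivity
  · intro n
    have hpt : ∀ j, ((fun j => if j ≤ N then L ^ (N - 1 - j) else (2 : ℝ) ^ j) j)⁻¹ ≤
        (if j ≤ N then (2 : ℝ) ^ j / 2 ^ (N - 1) else 0) + (if N < j then (1 / 2 : ℝ) ^ j else 0) := by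
      intro j
      dsimp only
      by_cases hj : j ≤ N
      · rw [if_pos hj, if_pos hj, if_neg (not_lt.2 hj), add_zero]
        exact inv_pow_le_two_pow_div hL N j
      · rw [if_neg hj, if_neg hj, if_pos (not_le.1 hj), zero_add, one_div, inv_pow]
    calc ∑ j ∈ Finset.Icc 1 n, ((fun j => if j ≤ N then L ^ (N - 1 - j) else (2 : ℝ) ^ j) j)⁻¹
        ≤ ∑ j ∈ Finset.Icc 1 n, ((if j ≤ N then (2 : ℝ) ^ j / 2 ^ (N - 1) else 0) + (if N < j then (1 / 2 : ℝ) ^ j else 0)) :=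
          Finset.sum_le_sum fun j _ => hpt j
      _ = _ := Finset.sum_add_distrib
      _ ≤ 4 + 2 := add_le_add (sum_head_le_four N n) (sum_tail_le_two N n)
      _ = 6 := by norm_num
  · intro i hi; dsimp only; rw [if_pos (by omega)]
  · intro j hj; dsimp only; rw [if_pos hj]

/-- ★★★ **ADMISSIBLE WEIGHTS, WEIGHT LINE v2** (architect px17 g23 2026-09-01T01:53:02Z: `w 1 := 1`, `w j := L^{N−1−j}` for `2 ≤ j ≤ N`; here `2^j` beyond `N`):
`W := 7` for every `L ≥ 2`, uniformly in `N`; the domination `w(i+1) ≤ L^{N−1−(i+1)}` holds at every `i < N` (at `i = 0`: `1 ≤ L^{N−2}`, with `L^0 = 1` when `N ≤ 2`).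
[cite: Balaban1985Averaging, Prop. 4 (128)-(135) pp.37-38] -/
theorem exists_admissible_weights_v2 {L : ℝ} (hL : 2 ≤ L) (N : ℕ) :
    ∃ w : ℕ → ℝ, (∀ j, 0 < w j) ∧ (∀ n, ∑ j ∈ Finset.Icc 1 n, (w j)⁻¹ ≤ 7) ∧
      (∀ i, i < N → w (i + 1) ≤ L ^ (N - 1 - (i + 1))) ∧ w 1 = 1 ∧ (∀ j, 2 ≤ j → j ≤ N → w j = L ^ (N - 1 - j)) := by
  have hL0 : 0 < L := by linarith
  have hL1 : 1 ≤ L := by linarith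
  refine ⟨fun j => if j = 1 then 1 else if j ≤ N then L ^ (N - 1 - j) else (2 : ℝ) ^ j, ?_, ?_, ?_, ?_, ?_⟩
  · intro j; dsimp only; split_ifs <;> positivity
  · intro n
    have hpt : ∀ j, ((fun j => if j = 1 then 1 else if j ≤ N then L ^ (N - 1 - j) else (2 : ℝ) ^ j) j)⁻¹ ≤
        (if j = 1 then (1 : ℝ) else 0) + ((if j ≤ N then (2 : ℝ) ^ j / 2 ^ (N - 1) else 0) + (if N < j then (1 / 2 : ℝ) ^ j else 0)) := by
      intro j
      dsimp only
      have hB : 0 ≤ (if j ≤ N then (2 : ℝ) ^ j / 2 ^ (N - 1) else 0) := by split_ifs <;> positivity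
      have hC : 0 ≤ (if N < j then (1 / 2 : ℝ) ^ j else 0) := by split_ifs <;> positivity
      by_cases h1 : j = 1
      · rw [if_pos h1, if_pos h1, inv_one]; linarith
      · rw [if_neg h1, if_neg h1, zero_add]
        by_cases hj : j ≤ N
        · rw [if_pos hj, if_pos hj, if_neg (not_lt.2 hj), add_zero]
          exact inv_pow_le_two_pow_div hL N j
        · rw [if_neg hj, if_neg hj, if_pos (not_le.1 hj), zero_add, one_div, inv_pow]
    have h1 : ∑ j ∈ Finset.Icc 1 n, (if j = 1 then (1 : ℝ) else 0) ≤ 1 := by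
      rw [Finset.sum_ite_eq']; split_ifs <;> norm_num
    calc ∑ j ∈ Finset.Icc 1 n, ((fun j => if j = 1 then 1 else if j ≤ N then L ^ (N - 1 - j) else (2 : ℝ) ^ j) j)⁻¹
        ≤ ∑ j ∈ Finset.Icc 1 n, ((if j = 1 then (1 : ℝ) else 0) + ((if j ≤ N then (2 : ℝ) ^ j / 2 ^ (N - 1) else 0) + (if N < j then (1 / 2 : ℝ) ^ j else 0))) :=
          Finset.sum_le_sum fun j _ => hpt j
      _ = ∑ j ∈ Finset.Icc 1 n, (if j = 1 then (1 : ℝ) else 0) +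
            (∑ j ∈ Finset.Icc 1 n, (if j ≤ N then (2 : ℝ) ^ j / 2 ^ (N - 1) else 0) + ∑ j ∈ Finset.Icc 1 n, (if N < j then (1 / 2 : ℝ) ^ j else 0)) := by
          rw [Finset.sum_add_distrib, Finset.sum_add_distrib]
      _ ≤ 1 + (4 + 2) := add_le_add h1 (add_le_add (sum_head_le_four N n) (sum_tail_le_two N n))
      _ = 7 := by norm_num
  · intro i hi
    dsimp only
    by_cases h1 : i + 1 = 1
    · rw [if_pos h1]; exact one_le_pow₀ hL1
    · rw [if_neg h1, if_pos (by omega)]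
  · simp
  · intro j hj2 hjN; dsimp only; rw [if_neg (by omega), if_pos hjN]

end Summit.QuantumFields.YangMills.Theorems.FluctuationComparisonRegPrIntLS2BetaAdmissibleWeights
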